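import Summits.AtomisticToContinuum.HydrodynamicLimit.Theses.KinematicRung
import Summits.AtomisticToContinuum.HydrodynamicLimit.Statement
import HarnessLib

/-!
# On-path lemma for the rung `KinematicMeanClosure`: `HydrodynamicLimit → KinematicMeanClosure`

Route `KinematicRung` (forward generator G1, next rung over the proved floor
`ResponseRigidity.MeanClosure`,
`Summit.AtomisticToContinuum.HydrodynamicLimit.Theorems.RestartPrinciple.AgeDuhamelForgetting.meanClosure_holds`).
Its rung, the crux `KinematicMeanClosure` (stmt-AtomisticToContinuum-20153; informally
`MeanClosureRung 2` of the graded family "k mean channels assumed on `[0,t]`", floor `k = 3`,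
statement `k = 0`), is the sub-problem statement `HydrodynamicLimit` with ONE extra hypothesis
inserted before the conclusion at time `t` (the kinematic-means history on `[0,t]`). Hence the
statement implies the rung by discarding that hypothesis — the ON-PATH lemma `S → Rung` of the
forward discipline (TRIBUNAL-FIT F4): the rung is a consequence of the statement, i.e. it lies on the
summit's path; the other end is pinned to the proved floor by the route's witness.

This file is pure logic (no analysis): `η`, `σ₀` are taken from the statement unchanged.

prover-fwd2-land-3-0 (on-path lander), 2026-08-18.
-/

namespace Summit.AtomisticToContinuum.HydrodynamicLimit.Theorems

open Summit.AtomisticToContinuum.HydrodynamicLimit.Theses.KinematicRung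

/-- **On-path lemma (F4) for the rung of route `KinematicRung`.** The packing-guarded hydrodynamic
limit `HydrodynamicLimit` implies the crux `KinematicMeanClosure`: the crux has the same quantifier
prefix (`∃ η > 0, ∀ profiles, ∃ σ₀ > 0, ∀ σ < σ₀, ∀ guarded Euler solution, ∀ Φ, LLN at 0 →
∀ t ∈ [0,T)`) and the same conclusion `TendstoHydroFieldsAt … t`, and only adds the kinematic-means
history hypothesis on `[0,t]`, which is discarded. -/
theorem KinematicMeanClosure_of_HydrodynamicLimit :
    _root_.HydrodynamicLimit → KinematicMeanClosure := by
  rintro ⟨η, hη, H⟩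
  refine ⟨η, hη, fun a₀ θ₀ u₀ ha hθ hu ha0 hθ0 => ?_⟩
  obtain ⟨σ₀, hσ₀, G⟩ := H a₀ θ₀ u₀ ha hθ hu ha0 hθ0
  exact ⟨σ₀, hσ₀, fun σ hσ hσ' T ρ θ u hsol hpack Φ h0 t ht _ =>
    G σ hσ hσ' T ρ θ u hsol hpack Φ h0 t ht⟩

end Summit.AtomisticToContinuum.HydrodynamicLimit.Theorems
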